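import Summits.QuantumFields.GaugeBoot.PlaquetteAverageLimit
import Literature.MathematicalPhysics.QuantumFieldTheory.Chatterjee2019LargeN.RealAnalyticity
import Mathlib.MeasureTheory.Integral.DominatedConvergence
import Mathlib.Analysis.SpecialFunctions.Integrals.Basic
import HarnessLib

/-!
# CHATTERJEE'S COROLLARY 3.4 — the limiting free energy of strongly coupled `SO(N)` lattice gauge theory — PROVED (gauge-boot, ADDENDUM 28 part Z6)

HONEST FRAMING (cell `pub-gaugeboot`, page 1 of every file): the venture produces certified bounds
on lattice expectations at stated coupling, gauge group, dimension and torus size; NOT a mass gap,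
NOT a continuum limit, NOT a string tension; NOT Yang–Mills-summit-bearing (barriers
`FixedCouplingUltralocality`, `PerturbativeInvisibility`).  Strong-coupling large-`N` `SO(N)` lattice gauge theory with free
boundary condition (S. Chatterjee, Comm. Math. Phys. **366** (2019)); nothing about four-dimensional continuum Yang–Mills
or a mass gap.

## Content

★★★ `limitingPartitionFunction_holds : LimitingPartitionFunction d` — the tree's named fact for **Corollary 3.4**: for
`|β| ≤ β₀(d)`, cubes `Λ_N = [−M_N, M_N]^d` with `M_N ↑ ∞` and any plaquette `p`,

  `log Z_{Λ_N,N,β} / (N² |Λ_N|) → (β d(d−1)/2) Σ_{X ∈ 𝒳((∂p))} w_β(X)/(δ(X)+1)`,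

the series being absolutely convergent.  Proof (the source's §15 with the torus replaced by the lane's quantitative
duality): `log Z = ∫₀^β N² Σ_q φ_{N,t}((∂q)) dt` (`log_soPartitionFunction_eq_integral_phi`); the integrand divided by
`N²|Λ_N|` converges to `(d(d−1)/2) T_t` for every `|t| ≤ |β|` (`tendsto_avg_phi_plaquette`) and is bounded by `d(d−1)/2`,
so the integrals converge (dominated convergence); and `∫₀^β T_t dt = β Σ_X w_β(X)/(δ(X)+1)` by integrating the power series
`T_t = Σ_k a_k t^k` term by term (`integral_trajectorySum_eq`; tree `hasSum_coeffA_mul_pow`, `hasSum_coeffA_mul_pow_div`).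
★★ `logPartitionPowerSeries_holds` — **Corollary 3.5, second display**, via the tree's
`logPartitionPowerSeries_of_limitingPartitionFunction`.  With ADDENDA 27–28 every named fact of the tree's
`Chatterjee2019LargeN` directory except the perimeter-free `AreaLawUpperBound` is now a theorem.

Everything is `[folklore]` given the source and the siblings.
-/

noncomputable section

open MeasureTheory Filter Topology
open Literature.Probability.LatticeModels (Site box)
open Literature.MathematicalPhysics.QuantumLattice (ZdPlaquette)
open Literature.MathematicalPhysics.QuantumFieldTheory (plaquettesIn)
open Literature.MathematicalPhysics.QuantumFieldTheory.Chatterjee2019LargeN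
open Literature.MathematicalPhysics.QuantumFieldTheory.Chatterjee2019LargeN.CoeffCatalanBoundProof

namespace Summit.QuantumFields.GaugeBoot

namespace StringDuality

variable {d : ℕ}

/-! ## Term-by-term integration of the string sum -/

/-- `|t| ≤ |β|` on the integration interval `Ι 0 β`. [folklore] -/
theorem abs_le_of_mem_uIoc {β t : ℝ} (ht : t ∈ Set.uIoc 0 β) : |t| ≤ |β| := by
  rw [Set.mem_uIoc] at ht
  rcases ht with ⟨h1, h2⟩ | ⟨h1, h2⟩
  · rw [abs_of_pos h1]; exact h2.trans (le_abs_self β)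
  · rw [abs_le]; constructor <;> linarith [neg_abs_le β, le_abs_self β]

variable (d)

/-- **`∫₀^β Σ_X w_t(X) dt = β Σ_X w_β(X)/(δ(X)+1)`** (the string sum is the power series `Σ_k a_k t^k`, integrated term by
term: «`∫₀^{β₁} w_β(X) dβ = β₁ w_{β₁}(X)/(δ(X)+1)`»), together with the absolute convergence of the right-hand side.
[cite: Chatterjee2019LargeN, §15 (last two displays of the proof of Corollary 3.4)] -/
theorem integral_trajectorySum_eq :
    ∃ β₀ : ℝ, 0 < β₀ ∧ ∀ β : ℝ, |β| ≤ β₀ → ∀ p : ZdPlaquette d,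
      Summable (fun X : Trajectory [plaquetteWord p] => X.weight β / (X.numDeform + 1)) ∧
        ∫ t in (0 : ℝ)..β, (∑' X : Trajectory [plaquetteWord p], X.weight t) =
          β * ∑' X : Trajectory [plaquetteWord p], X.weight β / (X.numDeform + 1) := by
  obtain ⟨β₁, hβ₁, H1⟩ := coeffA_mul_pow_summable_abs (d := d)
  have hK : (0 : ℝ) < 1 / (2 * bigK d ^ 5) := by have := one_le_bigK d; positivity
  refine ⟨min (1 / (2 * bigK d ^ 5)) β₁, lt_min hK hβ₁, fun β hβ p => ?_⟩
  have hb0 : |β| ≤ 1 / (2 * bigK d ^ 5) := hβ.trans (min_le_left _ _)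
  have hb1 : |β| ≤ β₁ := hβ.trans (min_le_right _ _)
  have hs : IsLoopSeq [plaquetteWord p] := isLoopSeq_plaquette p
  set a : ℕ → ℝ := fun k => coeffA [plaquetteWord p] k with ha
  -- summability of `w_β/(δ+1)`
  have hw : Summable fun X : Trajectory [plaquetteWord p] => X.weight β := (trajectorySum_summable_and_abs_le hb0 hs).1
  have hwd : Summable fun X : Trajectory [plaquetteWord p] => X.weight β / (X.numDeform + 1) := by
    refine Summable.of_norm_bounded (g := fun X => ‖X.weight β‖) hw.norm fun X => ?_
    rw [norm_div, Real.norm_eq_abs, Real.norm_eq_abs]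
    have h1 : (1 : ℝ) ≤ |(X.numDeform : ℝ) + 1| := by rw [abs_of_nonneg (by positivity)]; linarith [Nat.cast_nonneg (α := ℝ) X.numDeform]
    exact div_le_self (abs_nonneg _) h1
  refine ⟨hwd, ?_⟩
  -- the dominating sequence `|a_k| |β|^k`
  have hbound : Summable fun k : ℕ => |a k| * |β| ^ k := by
    have h := H1 β hb1 [plaquetteWord p] hs
    refine h.congr fun k => ?_
    rw [ha, abs_mul, abs_pow]
  -- term-by-term integration
  have hterm : HasSum (fun k : ℕ => ∫ t in (0 : ℝ)..β, a k * t ^ k)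
      (∫ t in (0 : ℝ)..β, ∑' X : Trajectory [plaquetteWord p], X.weight t) := by
    refine intervalIntegral.hasSum_integral_of_dominated_convergence (fun k _ => |a k| * |β| ^ k)
      (fun k => (Continuous.aestronglyMeasurable (by fun_prop))) (fun k => ae_of_all _ fun t ht => ?_)
      (ae_of_all _ fun t _ => hbound) intervalIntegrable_const (ae_of_all _ fun t ht => ?_)
    · rw [Real.norm_eq_abs, abs_mul, abs_pow]
      exact mul_le_mul_of_nonneg_left (pow_le_pow_left₀ (abs_nonneg t) (abs_le_of_mem_uIoc ht) k) (abs_nonneg _)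
    · have ht' : |t| ≤ 1 / (2 * bigK d ^ 5) := (abs_le_of_mem_uIoc ht).trans hb0
      exact hasSum_coeffA_mul_pow (trajectorySum_summable_and_abs_le ht' hs).1
  -- the term integrals
  have hk : ∀ k : ℕ, ∫ t in (0 : ℝ)..β, a k * t ^ k = β * (a k * β ^ k / (k + 1)) := by
    intro k
    rw [intervalIntegral.integral_const_mul, integral_pow, zero_pow (Nat.succ_ne_zero k), sub_zero, pow_succ]
    ring
  simp_rw [hk] at hterm
  have hser := (hasSum_coeffA_mul_pow_div hwd).mul_left β
  exact hterm.unique hser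

/-! ## Corollary 3.4 -/

/-- ★★★ **CHATTERJEE'S COROLLARY 3.4 (limiting partition function of `SO(N)` lattice gauge theory), PROVED** — the tree's
named fact `LimitingPartitionFunction`: for `|β| ≤ β₀(d)`, `Λ_N = [−M_N, M_N]^d ∩ ℤ^d` with `M_N` increasing to infinity
and any plaquette `p`, `lim_N log Z_{Λ_N,N,β}/(N²|Λ_N|) = (β d(d−1)/2) Σ_{X ∈ 𝒳(p)} w_β(X)/(δ(X)+1)`, the series absolutely
convergent.  (The source argues on the discrete torus; here the free boundary is handled directly by the lane's
quantitative gauge–string duality, the boundary layer having vanishing density.) [cite: Chatterjee2019LargeN, Corollary 3.4, §15] -/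
theorem limitingPartitionFunction_holds : LimitingPartitionFunction d := by
  intro hd
  obtain ⟨β₁, hβ₁, H1⟩ := tendsto_avg_phi_plaquette d hd
  obtain ⟨β₂, hβ₂, H2⟩ := integral_trajectorySum_eq d
  refine ⟨min β₁ β₂, lt_min hβ₁ hβ₂, fun M _ hM β hβ p => ?_⟩
  have hb1 : |β| ≤ β₁ := hβ.trans (min_le_left _ _)
  have hb2 : |β| ≤ β₂ := hβ.trans (min_le_right _ _)
  obtain ⟨hsum, hint⟩ := H2 β hb2 p
  refine ⟨hsum, ?_⟩
  set D : ℝ := (d : ℝ) * ((d : ℝ) - 1) / 2 with hDdef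
  have hD0 : 0 ≤ D := by rw [hDdef, ← card_pairsLT_real]; positivity
  -- the averaged plaquette values
  set g : ℕ → ℝ → ℝ := fun N t => (∑ q ∈ plaquettesIn (box d (M N)),
      (if h : q.2.1 < q.2.2 then phi N t (box d (M N)) [plaquetteWord ⟨q.1, ⟨(q.2.1, q.2.2), h⟩⟩] else 0)) /
        (box d (M N)).card with hg
  -- (a) `log Z_N / (N² |Λ_N|) = ∫₀^β g_N`
  have hlog : ∀ N : ℕ, N ≠ 0 →
      Real.log (soPartitionFunction N β (box d (M N))) / ((N : ℝ) ^ 2 * (box d (M N)).card) =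
        ∫ t in (0 : ℝ)..β, g N t := by
    intro N hN
    have hb : (0 : ℝ) < (box d (M N)).card := by exact_mod_cast card_box_pos (M N)
    have hN2 : (N : ℝ) ^ 2 ≠ 0 := by positivity
    rw [log_soPartitionFunction_eq_integral_phi N hN]
    have hsum' : ∀ t : ℝ, (∑ q ∈ (plaquettesIn (box d (M N))).attach,
        phi N t (box d (M N)) [plaquetteWord ⟨q.1.1, ⟨(q.1.2.1, q.1.2.2), (Iff.mp SOMasterLoop.mem_plaquettesIn_iff
          (show ((q.1.1, q.1.2.1, q.1.2.2) : Site d × Fin d × Fin d) ∈ plaquettesIn (box d (M N)) from q.2)).1⟩⟩]) =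
        ∑ q ∈ plaquettesIn (box d (M N)),
          (if h : q.2.1 < q.2.2 then phi N t (box d (M N)) [plaquetteWord ⟨q.1, ⟨(q.2.1, q.2.2), h⟩⟩] else 0) := by
      intro t
      rw [← Finset.sum_attach (plaquettesIn (box d (M N))) (fun q =>
        (if h : q.2.1 < q.2.2 then phi N t (box d (M N)) [plaquetteWord ⟨q.1, ⟨(q.2.1, q.2.2), h⟩⟩] else 0))]
      refine Finset.sum_congr rfl fun q _ => ?_
      rw [dif_pos (Iff.mp SOMasterLoop.mem_plaquettesIn_iff
        (show ((q.1.1, q.1.2.1, q.1.2.2) : Site d × Fin d × Fin d) ∈ plaquettesIn (box d (M N)) from q.2)).1]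
    simp_rw [hsum']
    rw [intervalIntegral.integral_const_mul, hg]
    simp_rw [div_eq_mul_inv]
    rw [intervalIntegral.integral_mul_const]
    field_simp
  -- (b) dominated convergence for `∫₀^β g_N`
  have hmeas : ∀ N : ℕ, Continuous (g N) := by
    intro N
    rw [hg]
    refine Continuous.div_const (continuous_finsetSum _ fun q _ => ?_) _
    split_ifs with h
    · exact continuous_phi_coupling N (box d (M N)) _
    · exact continuous_const
  have hgb : ∀ (N : ℕ) (t : ℝ), |g N t| ≤ D := by
    intro N t
    have hb : (0 : ℝ) < (box d (M N)).card := by exact_mod_cast card_box_pos (M N)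
    rw [hg, abs_div, abs_of_pos hb, div_le_iff₀ hb]
    calc |∑ q ∈ plaquettesIn (box d (M N)),
          (if h : q.2.1 < q.2.2 then phi N t (box d (M N)) [plaquetteWord ⟨q.1, ⟨(q.2.1, q.2.2), h⟩⟩] else 0)|
        ≤ ∑ q ∈ plaquettesIn (box d (M N)),
          |(if h : q.2.1 < q.2.2 then phi N t (box d (M N)) [plaquetteWord ⟨q.1, ⟨(q.2.1, q.2.2), h⟩⟩] else 0)| :=
          Finset.abs_sum_le_sum_abs _ _
      _ ≤ ∑ _q ∈ plaquettesIn (box d (M N)), (1 : ℝ) := by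
          refine Finset.sum_le_sum fun q _ => ?_
          split_ifs
          · exact abs_phi_le_one _ _ _ _
          · simp
      _ = (plaquettesIn (box d (M N))).card := by rw [Finset.sum_const, nsmul_eq_mul, mul_one]
      _ ≤ (box d (M N)).card * D := card_plaquettesIn_le _
      _ = D * (box d (M N)).card := mul_comm _ _
  have hlim : ∀ t ∈ Set.uIoc 0 β, Tendsto (fun N => g N t) atTop
      (𝓝 (D * ∑' X : Trajectory [plaquetteWord p], X.weight t)) := fun t ht =>
    H1 M hM t ((abs_le_of_mem_uIoc ht).trans hb1) p
  have hdct : Tendsto (fun N => ∫ t in (0 : ℝ)..β, g N t) atTop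
      (𝓝 (∫ t in (0 : ℝ)..β, D * ∑' X : Trajectory [plaquetteWord p], X.weight t)) := by
    refine intervalIntegral.tendsto_integral_filter_of_dominated_convergence (fun _ => D)
      (Eventually.of_forall fun N => (hmeas N).aestronglyMeasurable)
      (Eventually.of_forall fun N => ae_of_all _ fun t _ => ?_) intervalIntegrable_const
      (ae_of_all _ fun t ht => hlim t ht)
    rw [Real.norm_eq_abs]
    exact hgb N t
  rw [intervalIntegral.integral_const_mul, hint] at hdct
  have hval : D * (β * ∑' X : Trajectory [plaquetteWord p], X.weight β / (X.numDeform + 1)) =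
      β * d * ((d : ℝ) - 1) / 2 * ∑' X : Trajectory [plaquetteWord p], X.weight β / (X.numDeform + 1) := by
    rw [hDdef]; ring
  rw [hval] at hdct
  refine hdct.congr' ?_
  filter_upwards [eventually_ge_atTop 1] with N hN
  exact (hlog N (by omega)).symm

/-- ★★ **Corollary 3.5, second display (the rescaled log-partition function as a power series), PROVED**:
`lim_N log Z_{Λ_N,N,β}/(N²|Λ_N|) = (d(d−1)/2) Σ_k a_k((p)) β^{k+1}/(k+1)`, absolutely convergent.
[cite: Chatterjee2019LargeN, Corollary 3.5 (second display)] -/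
theorem logPartitionPowerSeries_holds : LogPartitionPowerSeries d :=
  logPartitionPowerSeries_of_limitingPartitionFunction (limitingPartitionFunction_holds d)

end StringDuality

end Summit.QuantumFields.GaugeBoot

end
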